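import Summits.AtomisticToContinuum.Crystallization.Theorems.ChartedZeroExcessLayeredLatticeLiouvilleZZZT
import Summits.AtomisticToContinuum.Crystallization.Theorems.ChartedZeroExcessLayeredLatticeLiouvilleTW

/-!
# ChartedZeroExcess · LayeredLatticeLiouville ZZZU (lens-2 g88 NODE 88) — «MotionDichotomy»: THE TUBE-GEOMETRY LEAF (TGᴸ) OF W2‴ DECIDED BY THE
# NEAR-IDENTITY / GENUINE-ROTATION DICHOTOMY OF THE RIGID MOTION — (TGᴸ)(m₀ = 10⁻⁴) ⟸ (BXᴸ) «off the outer tube some `Rg`-label pair of core sites has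
# vector bond deviation `> sb`» PROVED (bond price of a near-identity motion vs collar price of a far one, from a SIX-SITE COLLAR FRAME); (BXᴸ) ⟸ (UXᴸ)
# «a core site `dB`-far from its label forces such a pair» PROVED; (UXᴸ) = the one residual leaf (kinematic, `y`-free, motion-free); W2⁗ DOORS PROVED

Lineage `stmt-AtomisticToContinuum-26636` (route ChartedPlanarOrder, `ChartedZeroExcessLayered`), lens-2 «structural dichotomy (special vs generic)» g88.
BLOCKER FIRST: critic row 1570 (g87 «RigidQuotient» VERIFIED; W2‴ `[MCMC](ϑc) ⟸ (SC) ∧ (X1ᴸ) ∧ (X2ᴸ) ∧ (RGᴸ)(cR) ∧ (TGᴸ)(m₀) ∧ (DWᴹ)(cE, σ₀)` =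
energetic route of record; ORDER for g88: plan A = formalise (TGᴸ) first (S/M); the ERRATUM docline of row 1569 folds into this file — see ERRATUM below).

THE LENS APPLIED INSIDE (TGᴸ).  (TGᴸ) asks, for an off-tube core `xf`, EVERY inner-tube filling `y` and EVERY proper rigid motion `(R, c)`, that
`rigidMisfit y xf R c = Σ_i ‖xf i − (R (y i) + c)‖² ≥ m₀`.  SPECIAL class = the `κ`-NEAR-IDENTITY motions `∀ v, ‖R v − v‖ ≤ κ‖v‖` (all translations, the
small rotations): the violated OUTER BOND CLAUSE `sb < dist (xf i − xf j) (lab (xf i) − lab (xf j))` on an `Rg`-label pair (supplied by (BXᴸ)) is paid at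
its two endpoints, ★ `rigidMisfit ≥ ½(sb − sb₁ − κ(Rg + sb₁))²` (`rigidMisfit_bondClause_nearId`, PROVED: inner bond clause `≤ sb₁`, defect of `R` on the
filling's bond `≤ κ(Rg + sb₁)`, and `‖a‖² + ‖b‖² ≥ ½‖a − b‖²`).  GENERIC class = the `κ`-FAR motions `∃ v, κ‖v‖ < ‖R v − v‖` (genuine rotations): the
linear defect `T := R − id` is then large on EVERY frame — for three label bonds `d_m` with axial parts `≥ L` along an orthonormal basis and off-axis parts
`≤ w`, `(L²/2 − 2w²)·‖v‖² ≤ Σ_m ⟪d_m, v⟫²` (`frame_of_perturbedAxes`) and `g·‖T v‖² ≤ ‖v‖²·Σ_m ‖T d_m‖²` (`frame_mul_norm_sq_map_le`), so some `‖T d_m‖ ≥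
tκ/√3`-worth survives (`Σ_m ‖T d_m‖ ≥ t·κ`, `t² ≤ g`); at a pair of `ε`-REGISTERED, `dI₁`-PINNED sites carrying `d_m` the two misfit terms see `T d_m` up to
`2(ε + dI₁)` each, ★ `rigidMisfit ≥ ½(t·κ − 2u(ε + dI₁))²` with `u² ≥ 3` (`rigidMisfit_collar_farId`, PROVED).  EXHAUSTION = excluded middle on the
near-identity predicate.  No screw-axis normal form, no shell sums, no determinant (the hypothesis `det R = 1` of (TGᴸ) is not used): det-free linear
algebra plus the covering radius `< 9/10` of clean sets (tree TW, XXIII.1) — which is why plan A's «screw-axis lemma + shell sum» was traded for the frame.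

THE COLLAR FRAME (`exists_collarFrame`, PROVED; probe `exists_collarProbe`).  For each of the six unit directions `u = ±b_m` let `k_u ∈ K` MAXIMISE `⟪·, u⟫`
over the (finite, nonempty) container and take the atom of `S` within `9/10` of `k_u + rC·u` (covering radius): it is a CORE site (`rC + 9/10 ≤ ρ`), it
is COOL — `⟪p − k, u⟫ ≥ ⟪p − k_u, u⟫ > rC − 9/10 > rΘ` for every `k ∈ K` by the extremality of `k_u` — hence REGISTERED by clause (iv) of the bond label
(`dist p (lab p) ≤ ε`, zone `ρ ≤ ℓ`), and its label is within `ε + 9/10 + (ρ + 9/10 − rC) + 9/10 ≤ Rg` of the atom near `k_u + (ρ + 9/10)·u`, which lies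
OUTSIDE the core by extremality again — so every inner-tube `y` is INTERFACE-PINNED there (`dist (y i) (lab (xf i)) ≤ dI₁`).  The six sites are pairwise
distinct (`probe_ne`: probes at right or obtuse angles are `> 0` apart once `rC ≥ 9/5`); the three label differences `lab⁺_m − lab⁻_m` have axial part
`≥ 2rC − 2(9/10 + ε) =: L` and off-axis part `≤ 2q + 2(9/10 + ε) =: w` (`norm_perp_decomp_le`).

PIECES (statements over tree notions only; binders of (TGᴸ) verbatim as far as they go).
* ★★★ (BXᴸ) `OffTubeBondExitP … Rg sb dI dB …` — under the binders of (TGᴸ) up to and including `xf ∉ bondTube (S ∖ core) Rg sb dI dB (lab ∘ xf)` (NO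
  filling `y`, NO motion): some `i ≠ j` have `dist (lab (xf i)) (lab (xf j)) ≤ Rg` and `sb < dist (xf i − xf j) (lab (xf i) − lab (xf j))` — of the three
  ways to leave the tube (bond / interface / bulk clause) the BOND exit always occurs.  KINEMATIC · LJ-free · `y`-free · motion-free · NEW · UNDECIDED ·
  TRUE-type at the fat door · IMPLIES (TGᴸ)(10⁻⁴) there (`offTubeRigidGapP_fat`, PROVED) · FOLLOWS from (UXᴸ) (`offTubeBondExitP_of_bulkExit`, PROVED:
  a failed bond clause with `i = j` is impossible for `sb ≥ 0`; a failed INTERFACE clause sits either at a cool-zone site — registered, `ε ≤ dI`,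
  contradiction — or at a hot site `dist (xf i) k ≤ rΘ`, where the exterior witness `p ∉ core` (`dist p k > ρ`, `dist (lab (xf i)) p ≤ Rg`) puts the
  label `> ρ − Rg − rΘ ≥ dB` away: a BULK exit; so only bulk exits remain) · TWO-SIDED INSTRUMENTABLE «BondExit-T» (per off-tube sample: max over
  `Rg`-label pairs of the vector bond deviation, vs `sb`).  Why it might fail: only through (UXᴸ).
* ★★★ (UXᴸ) `OffTubeBulkExitP … Rg sb dB …` — THE RESIDUAL LEAF: under the binders of (TGᴸ) up to the bond label (no tube hypothesis, no `y`, no motion):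
  if some core site has `dB < dist (xf i) (lab (xf i))` then some `i' ≠ j'` have `dist (lab (xf i')) (lab (xf j')) ≤ Rg` and `sb < dist (xf i' − xf j')
  (lab (xf i') − lab (xf j'))`.  KINEMATIC (propagation of the label deviation `e := xf − lab ∘ xf` along label chains) · LJ-free · `y`-free · motion-free
  · NEW · UNDECIDED · TRUE-type at the fat door `(Rg, sb, dB, ε, rΘ, q, ρ, ℓ) = (121/25, 249/5000, 21/50, 10⁻⁴, 145/16, 4, 16, 43/2)` by the
  LABEL-GEODESIC CHAIN: suppose every `Rg`-label pair of core sites had deviation difference `≤ sb`; the `dB`-far site `p₀` is θ-HOT (cool core sites are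
  registered, `ε < dB`); with `u := (p₀ − x₀)/‖p₀ − x₀‖` and `k_u` as in the collar frame, `dist (p₀, k_u)² ≤ rΘ² + q²` (`< 9.91`) and the cap point `z :=
  k_u + (rΘ + 2.2)·u` has `ball(z, 1.1)` cool and inside `ball(k_u, 12.4) ⊆ core`; bonds go to bonds INJECTIVELY (clauses (b), (c)) and a site of the
  shadow crystal has exactly twelve bonded sites, so `lab` maps the twelve contact neighbours of a zone-interior atom ONTO the twelve crystal neighbours
  of its label — a crystal geodesic `lab p₀ = c₀, c₁, …, c_N` towards `c₀ + (z − p₀)` (length `N ≤ √2·‖z − p₀‖ + 2 ≤ √2·15.3 + 2 < 24`, lateral wiggle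
  `≤ 1/√2`) therefore LIFTS to a contact chain `p₀, p₁, …, p_N` of atoms with `lab p_s = c_s`; sites `≤ 4` steps apart are `Rg`-label pairs (`4·28/25 =
  4.48 ≤ Rg`), so along the chain `‖e(p_s) − e(p₀)‖ ≤ ⌈s/4⌉·sb ≤ 6·sb = 0.3` — the atoms follow the translated geodesic within `0.3 + 1/√2`, stay within
  `13.5` of `k_u` (both ends of the segment `[p₀, z]` are within `11.3` of `k_u`; `+ 17/16` for the neighbour margin: CORE throughout), and `p_N` lands in
  `ball(z, 1.1)`: cool, registered, `‖e(p_N)‖ ≤ ε`, whence `dB < ‖e(p₀)‖ ≤ ε + 6·sb = 0.2989 < 0.42 = dB` — contradiction (`H = 6` hops; the budget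
  `(dB − ε)/sb = 8.4` would even allow `8`) · TWO-SIDED INSTRUMENTABLE «BulkChain-T» (hop count from `dB`-far sites to the registered zone vs `8.4`;
  g87's desk `rigid_gap.py` found `H = 3–4`) · ATTACKABLE-M (three lemmas: the local label bijection [needs the twelve-neighbour structure of `placedCrystal`
  sites at bond range `≤ 28/25`], a constructive crystal geodesic with bounded wiggle, and the hop telescoping; all geometry of the cap is this file's
  `exists_collarProbe`).  Antitone in `sb`, monotone in `Rg, dB` (`OffTubeBulkExitP.mono`); vacuous for `q < 0` (`offTubeBulkExitP_of_q_neg`).  Why it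
  might fail: a hot core so placed that every label chain to the registered zone needs `> 8` hops while staying in the core — excluded at the record
  dials by the count above (margin: 6 needed, 8 allowed, core slack `16 − 13.5`), but the local label bijection must be certified for the shadow crystal.

NET (0 sorry).  `rigidMisfit_bondClause_nearId` (special price) · `frame_mul_norm_sq_map_le`, `frame_of_perturbedAxes`, `sum_le_mul_sqrt_sum_sq`,
`rigidMisfit_collar_farId` / `…'` (generic price) · `exists_collarProbe`, `probe_ne`, `exists_collarFrame` (the frame) · `offTubeBondExitP_of_bulkExit`
(UXᴸ) ⟹ (BXᴸ) · ★ `offTubeRigidGapP_of_bondExit` (BXᴸ) ⟹ (TGᴸ)(m₀) for every `m₀` under both prices, `offTubeRigidGapP_of_bulkExit` · ★ THE FAT-DOOR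
INSTANCE `offTubeRigidGapP_fat`: (BXᴸ)_fat ⟹ (TGᴸ)(m₀ = 10⁻⁴) for ALL inner radii `sb₁, dI₁ ≤ sb/4` (any `dB₁`), with `rC = 15`, `κ = 9/2000`, `t =
1433/100` (`t² = 205.35 ≤ L²/2 − 2w² = 205.53`, `L = 28.1998`, `w = 9.8002`), `u = 17321/10000`: bond price `≥ ½(31/2000)² = 1.20·10⁻⁴`, collar price
`≥ ½(21/1000)² = 2.2·10⁻⁴` (the optimum of this six-site frame is `κ* ≈ 4.2·10⁻³`, `m₀* ≈ 1.43·10⁻⁴`; g87's desk `5.5·10⁻⁴` summed all 16 690 shell sites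
— `frame_mul_norm_sq_map_le` is stated for any finite frame `ι`, so a many-probe refinement is open, but the door needs only `m₀ > 0`) · `offTubeBondExitP_fat`
· DOORS `mildCoolMoatCorePG_W2''''_fat_of_bondExit` and ★ `mildCoolMoatCorePG_W2''''`:
**`[MCMC](ϑc)` ⟸ (SC) ∧ (X1ᴸ)(lam > 0) ∧ (X2ᴸ) ∧ (RGᴸ)(cR) ∧ (UXᴸ)_fat ∧ (DWᴹ)(cE, σ₀)**, `0 ≤ cR`, `0 ≤ cE`, `σ₀ < cE·cR·10⁻⁴` (W2⁗; at the desk values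
`cE ≈ 5.5·10⁻⁴`, `cR ≈ 21.5` the admissible slack is `σ₀ < 1.2·10⁻⁶` — `σ₀ = 0` is the census target; W2″ stays the fallback for larger `σ₀`, critic row
1570).  RESIDUAL-DECIDING ITEMS of the W2 line after this node: (X1ᴸ), (X2ᴸ), (RGᴸ), (UXᴸ), (DWᴹ) [+ (SC)]; (TGᴸ) RETIRED as «⟸ (BXᴸ) ⟸ (UXᴸ), PROVED at
`m₀ = 10⁻⁴`».  WHY EACH NEW PIECE IS NOT THE OLD ONE IN COSTUME: (BXᴸ)/(UXᴸ) quantify over NO filling and NO motion — they are statements about one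
off-tube core and its bond label, strictly inside the telescope of (TGᴸ); (UXᴸ) does not mention the tube at all.  CONFIRMATION OWED TO ROW 1569 («the one
inequality r(cool) < ρ − Rg»): here it is the hypothesis `dB ≤ ρ − Rg − rΘ` of `offTubeBondExitP_of_bulkExit`, `21/50 ≤ 16 − 121/25 − 145/16 = 2.0975` at
the record dials (PROVED instance `offTubeBondExitP_fat`) — the interface exit is dead.
ERRATUM (critic row 1569, owed by lens-2, docline only — no re-landing of ZZZS): (RDᴸ)'s docstring «D₀ ≈ 1.4·10³·(sb − sb₁)² expected at Rd = Rg» priced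
the MONOMER and is superseded by «D₀ ≈ (N_Rg + 1)·(sb − sb₁ − φ*|b|)² ≈ 0.78 (dimer on a long edge inside the rigid zone; census DEFFLOOR e06231f1, critic
row 1569)»; D₀ of record for the direct floor is `3/4` (provisional, row 1569); the quotient route of W2‴/W2⁗ uses `cR·m₀` instead.
Sources: tree ZZZTA/ZZZT (NODE 87), ZZZS (NODE 86), TW XXIII.1 (covering radius), ZC (bond labels), YOA (bond tube); W. Kabsch, Acta Cryst. A32 (1976) 922;
G. Friesecke, R. D. James, S. Müller, CPAM 55 (2002) 1461 (the rigidity side, untouched here); memo NODE-g88.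

0 sorry; imports = tree ZZZT + TW only; axioms standard (`#print axioms mildCoolMoatCorePG_W2''''` = propext, Classical.choice, Quot.sound).
-/

noncomputable section
open scoped BigOperators Classical InnerProductSpace RealInnerProductSpace
open MeasureTheory Set Metric Filter Topology
open Literature.Geometry.DiscreteGeometry (IsTwoShellGoodSet)
open Literature.MathematicalPhysics.StatisticalMechanics (lennardJones card_le_of_separated_of_dist_le)

namespace Summit.AtomisticToContinuum.Crystallization.Theorems.ChartedZeroExcessLayeredLatticeLiouville

open Summit.AtomisticToContinuum.Crystallization.Theorems.ChartedPlanarOrderRigidityDoor (E3 IsClean)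
open Summit.AtomisticToContinuum.Crystallization.Theorems.ChartedPlanarOrderDensityDichotomy (μS IsSep)
open Summit.AtomisticToContinuum.Crystallization.Theorems.ChartedPlanarOrderCleanScaleP (IsCleanP IsDoorSetP)
open Summit.AtomisticToContinuum.Crystallization.Theorems.ChartedPlanarOrderMesoCut (LayeredHom EnvClose)
open Summit.AtomisticToContinuum.Crystallization.Theorems.ChartedPlanarOrderDoorLayeredOsc (IsTwoShellAffineGood)

/-! ### ZZZU-1  Linear algebra of the generic (far-from-identity) class: frame bound ⇒ Frobenius ≥ operator -/

section FrameAlgebra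

/-- ★ **FROBENIUS DOMINATES OPERATOR ON A FRAME (PROVED)**: if the cloud `d` has frame bound `g` (`g‖v‖² ≤ Σ_m ⟪d m, v⟫²` for all `v`), then for
every linear `T` and every `v`: `g·‖T v‖² ≤ ‖v‖² · Σ_m ‖T (d m)‖²` (Parseval in an orthonormal basis, `⟪b l, T d⟫ = ⟪T† b l, d⟫`, the frame bound
at `T† b l`, `Σ_l ‖T† b l‖² = Σ_l ‖T b l‖²`, Cauchy–Schwarz).  The engine of the collar price: a proper rigid motion far from the identity moves SOME
frame vector. [this file, g88] -/
theorem frame_mul_norm_sq_map_le {ι : Type*} [Fintype ι] (T : E3 →ₗ[ℝ] E3) (d : ι → E3) {g : ℝ} (hg : 0 ≤ g)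
    (hframe : ∀ v : E3, g * ‖v‖ ^ 2 ≤ ∑ m, ⟪d m, v⟫_ℝ ^ 2) (v : E3) :
    g * ‖T v‖ ^ 2 ≤ ‖v‖ ^ 2 * ∑ m, ‖T (d m)‖ ^ 2 := by
  set b : OrthonormalBasis (Fin 3) ℝ E3 := EuclideanSpace.basisFun (Fin 3) ℝ with hb
  set F : ℝ := ∑ l, ‖T (b l)‖ ^ 2 with hF
  have h1 : ∑ m, ‖T (d m)‖ ^ 2 = ∑ l, ∑ m, ⟪d m, LinearMap.adjoint T (b l)⟫_ℝ ^ 2 := by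
    rw [Finset.sum_comm]
    refine Finset.sum_congr rfl fun m _ => ?_
    rw [← b.sum_sq_inner_left (T (d m))]
    refine Finset.sum_congr rfl fun l _ => ?_
    rw [LinearMap.adjoint_inner_right]
  have h2 : g * ∑ l, ‖LinearMap.adjoint T (b l)‖ ^ 2 ≤ ∑ m, ‖T (d m)‖ ^ 2 := by
    rw [h1, Finset.mul_sum]
    exact Finset.sum_le_sum fun l _ => hframe _
  have h3 : ∑ l, ‖LinearMap.adjoint T (b l)‖ ^ 2 = F := by
    have e1 : ∀ l, ‖LinearMap.adjoint T (b l)‖ ^ 2 = ∑ l', ⟪b l, T (b l')⟫_ℝ ^ 2 := fun l => by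
      rw [← b.sum_sq_inner_left (LinearMap.adjoint T (b l))]
      refine Finset.sum_congr rfl fun l' _ => ?_
      rw [LinearMap.adjoint_inner_left]
    simp_rw [e1]
    rw [Finset.sum_comm]
    exact Finset.sum_congr rfl fun l' _ => b.sum_sq_inner_right _
  have h4 : ‖T v‖ ^ 2 ≤ ‖v‖ ^ 2 * F := by
    have hv : T v = ∑ l, ⟪b l, v⟫_ℝ • T (b l) := by
      conv_lhs => rw [← b.sum_repr' v]
      rw [map_sum]
      simp_rw [map_smul]
    have hle : ‖T v‖ ≤ ∑ l, |⟪b l, v⟫_ℝ| * ‖T (b l)‖ := by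
      rw [hv]
      refine (norm_sum_le _ _).trans (le_of_eq ?_)
      refine Finset.sum_congr rfl fun l _ => ?_
      rw [norm_smul, Real.norm_eq_abs]
    have hcs := Finset.sum_mul_sq_le_sq_mul_sq Finset.univ (fun l => |⟪b l, v⟫_ℝ|) (fun l => ‖T (b l)‖)
    have hsq : ∑ l, |⟪b l, v⟫_ℝ| ^ 2 = ‖v‖ ^ 2 := by
      simp_rw [sq_abs]; exact b.sum_sq_inner_right v
    calc ‖T v‖ ^ 2 ≤ (∑ l, |⟪b l, v⟫_ℝ| * ‖T (b l)‖) ^ 2 := pow_le_pow_left₀ (norm_nonneg _) hle 2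
      _ ≤ (∑ l, |⟪b l, v⟫_ℝ| ^ 2) * ∑ l, ‖T (b l)‖ ^ 2 := hcs
      _ = ‖v‖ ^ 2 * F := by rw [hsq]
  calc g * ‖T v‖ ^ 2 ≤ g * (‖v‖ ^ 2 * F) := mul_le_mul_of_nonneg_left h4 hg
    _ = ‖v‖ ^ 2 * (g * F) := by ring
    _ ≤ ‖v‖ ^ 2 * ∑ m, ‖T (d m)‖ ^ 2 := mul_le_mul_of_nonneg_left (h3 ▸ h2) (sq_nonneg _)

/-- elementary: `x²/2 − y² ≤ (x + y)²` (landing lane: PRIVATE dedup token — the same inequality is `Literature.Analysis.Complex.half_sq_sub_sq_le_sq_add`). [formal bookkeeping] -/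
private theorem half_sq_sub_sq_le_add_sq (x y : ℝ) : x ^ 2 / 2 - y ^ 2 ≤ (x + y) ^ 2 := by nlinarith [sq_nonneg (x + 2 * y)]

/-- ★ **FRAME BOUND OF THREE PERTURBED AXES (PROVED)**: with `b` an orthonormal basis, if `⟪d m, b m⟫ ≥ L ≥ 0` and the part of `d m` orthogonal to
`b m` has norm `≤ w` (`m = 0, 1, 2`), then `(L²/2 − 2w²)·‖v‖² ≤ Σ_m ⟪d m, v⟫²` for every `v` (per axis `⟪d m, v⟫ = ⟪d m, b m⟫⟪b m, v⟫ + ⟪r m, v⟫` with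
`⟪r m, v⟫² ≤ w²(‖v‖² − ⟪b m, v⟫²)`, then Parseval).  The collar cloud of §ZZZU-3 is such a frame (`L = 2s − 2(9/10 + ε)`, `w = 2q + 2(9/10 + ε)`).
[this file, g88] -/
theorem frame_of_perturbedAxes (b : OrthonormalBasis (Fin 3) ℝ E3) (d : Fin 3 → E3) {L w : ℝ} (hL : 0 ≤ L)
    (hax : ∀ m, L ≤ ⟪d m, b m⟫_ℝ) (hperp : ∀ m, ‖d m - ⟪d m, b m⟫_ℝ • b m‖ ≤ w) (v : E3) :
    (L ^ 2 / 2 - 2 * w ^ 2) * ‖v‖ ^ 2 ≤ ∑ m, ⟪d m, v⟫_ℝ ^ 2 := by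
  have key : ∀ m, (L ^ 2 / 2) * ⟪b m, v⟫_ℝ ^ 2 - w ^ 2 * (‖v‖ ^ 2 - ⟪b m, v⟫_ℝ ^ 2) ≤ ⟪d m, v⟫_ℝ ^ 2 := by
    intro m
    set r : E3 := d m - ⟪d m, b m⟫_ℝ • b m with hr
    have hdm : d m = ⟪d m, b m⟫_ℝ • b m + r := by rw [hr]; abel
    have hsplit : ⟪d m, v⟫_ℝ = ⟪d m, b m⟫_ℝ * ⟪b m, v⟫_ℝ + ⟪r, v⟫_ℝ := by
      conv_lhs => rw [hdm]
      rw [inner_add_left, real_inner_smul_left]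
    have hrb : ⟪r, b m⟫_ℝ = 0 := by
      rw [hr, inner_sub_left, real_inner_smul_left, real_inner_self_eq_norm_sq, b.orthonormal.1 m]; ring
    have hv' : ⟪r, v⟫_ℝ = ⟪r, v - ⟪b m, v⟫_ℝ • b m⟫_ℝ := by
      rw [inner_sub_right, real_inner_smul_right, hrb]; ring
    have hn : ‖v - ⟪b m, v⟫_ℝ • b m‖ ^ 2 = ‖v‖ ^ 2 - ⟪b m, v⟫_ℝ ^ 2 := by
      rw [← real_inner_self_eq_norm_sq, inner_sub_left, inner_sub_right, inner_sub_right, real_inner_smul_left, real_inner_smul_right,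
        real_inner_smul_left, real_inner_smul_right, real_inner_self_eq_norm_sq, real_inner_self_eq_norm_sq, b.orthonormal.1 m,
        real_inner_comm v (b m)]
      ring
    have hcs : ⟪r, v⟫_ℝ ^ 2 ≤ w ^ 2 * (‖v‖ ^ 2 - ⟪b m, v⟫_ℝ ^ 2) := by
      rw [hv', ← hn, ← mul_pow]
      have h1 : |⟪r, v - ⟪b m, v⟫_ℝ • b m⟫_ℝ| ≤ ‖r‖ * ‖v - ⟪b m, v⟫_ℝ • b m‖ := abs_real_inner_le_norm _ _
      have h2 : ‖r‖ * ‖v - ⟪b m, v⟫_ℝ • b m‖ ≤ w * ‖v - ⟪b m, v⟫_ℝ • b m‖ := mul_le_mul_of_nonneg_right (hperp m) (norm_nonneg _)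
      exact sq_le_sq' (by linarith [abs_le.1 (h1.trans h2)]) (abs_le.1 (h1.trans h2)).2
    have hA : (L ^ 2 / 2) * ⟪b m, v⟫_ℝ ^ 2 ≤ (⟪d m, b m⟫_ℝ * ⟪b m, v⟫_ℝ) ^ 2 / 2 := by
      rw [mul_pow]
      have : L ^ 2 ≤ ⟪d m, b m⟫_ℝ ^ 2 := pow_le_pow_left₀ hL (hax m) 2
      nlinarith [sq_nonneg ⟪b m, v⟫_ℝ]
    rw [hsplit]
    linarith [half_sq_sub_sq_le_add_sq (⟪d m, b m⟫_ℝ * ⟪b m, v⟫_ℝ) ⟪r, v⟫_ℝ]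
  have hsum := Finset.sum_le_sum fun m (_ : m ∈ Finset.univ) => key m
  have hP : ∑ m, ⟪b m, v⟫_ℝ ^ 2 = ‖v‖ ^ 2 := b.sum_sq_inner_right v
  have hL : ∑ m : Fin 3, ((L ^ 2 / 2) * ⟪b m, v⟫_ℝ ^ 2 - w ^ 2 * (‖v‖ ^ 2 - ⟪b m, v⟫_ℝ ^ 2)) =
      (L ^ 2 / 2) * ‖v‖ ^ 2 - w ^ 2 * (3 * ‖v‖ ^ 2 - ‖v‖ ^ 2) := by
    rw [Finset.sum_sub_distrib, ← Finset.mul_sum, ← Finset.mul_sum, Finset.sum_sub_distrib, hP]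
    simp
  rw [hL] at hsum
  linarith

end FrameAlgebra

/-! ### ZZZU-2  The two prices of a proper rigid motion: the bond price of the SPECIAL class (near the identity) and the collar price of the GENERIC
class (far from the identity) -/

section Prices

variable {n : ℕ} {y₀ y xf : Fin n → E3} {R : E3 ≃ₗᵢ[ℝ] E3} {c : E3}

/-- ★★ **THE BOND PRICE OF A NEAR-IDENTITY MOTION (PROVED)** — the special class of the dichotomy.  If `‖R v − v‖ ≤ κ‖v‖` for all `v` and some
`Rg`-label pair `(i, j)`, `i ≠ j`, violates the OUTER bond clause (`sb < dist (xf i − xf j) (y₀ i − y₀ j)`) while `y` obeys the INNER one (`dist (y i − y j)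
(y₀ i − y₀ j) ≤ sb₁`), then `(sb − sb₁ − κ(Rg + sb₁))²/2 ≤ rigidMisfit y xf R c`: the pair difference `e_i − e_j = (xf i − xf j) − R (y i − y j)` kills
the translation, the near-identity bound kills the rotation up to `κ‖y i − y j‖ ≤ κ(Rg + sb₁)`. [this file, g88] -/
theorem rigidMisfit_bondClause_nearId {Rg sb sb₁ κ : ℝ} (hκ : 0 ≤ κ) (hnear : ∀ v : E3, ‖R v - v‖ ≤ κ * ‖v‖) {i j : Fin n} (hij : i ≠ j)
    (hRg : dist (y₀ i) (y₀ j) ≤ Rg) (hoff : sb < dist (xf i - xf j) (y₀ i - y₀ j)) (hin : dist (y i - y j) (y₀ i - y₀ j) ≤ sb₁)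
    (h0 : 0 ≤ sb - sb₁ - κ * (Rg + sb₁)) : (sb - sb₁ - κ * (Rg + sb₁)) ^ 2 / 2 ≤ rigidMisfit y xf R c := by
  set ei : E3 := xf i - (R (y i) + c) with hei
  set ej : E3 := xf j - (R (y j) + c) with hej
  have hin' : ‖(y i - y j) - (y₀ i - y₀ j)‖ ≤ sb₁ := by rwa [dist_eq_norm] at hin
  have hRg' : ‖y₀ i - y₀ j‖ ≤ Rg := by rwa [dist_eq_norm] at hRg
  have hoff' : sb < ‖(xf i - xf j) - (y₀ i - y₀ j)‖ := by rwa [dist_eq_norm] at hoff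
  -- the pair identity: the translation cancels
  have hre : (xf i - xf j) - (y₀ i - y₀ j) = (ei - ej) + (R (y i - y j) - (y i - y j)) + ((y i - y j) - (y₀ i - y₀ j)) := by
    rw [hei, hej, map_sub]; abel
  have hyb : ‖y i - y j‖ ≤ Rg + sb₁ := by
    have := norm_le_norm_sub_add (y i - y j) (y₀ i - y₀ j)
    linarith
  have hrot : ‖R (y i - y j) - (y i - y j)‖ ≤ κ * (Rg + sb₁) := (hnear _).trans (mul_le_mul_of_nonneg_left hyb hκ)
  have hlow : sb - sb₁ - κ * (Rg + sb₁) < ‖ei - ej‖ := by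
    have h1 : ‖(xf i - xf j) - (y₀ i - y₀ j)‖ ≤ ‖ei - ej‖ + ‖R (y i - y j) - (y i - y j)‖ + ‖(y i - y j) - (y₀ i - y₀ j)‖ := by
      rw [hre]; exact norm_add₃_le
    linarith
  have hsq : (sb - sb₁ - κ * (Rg + sb₁)) ^ 2 ≤ ‖ei - ej‖ ^ 2 := pow_le_pow_left₀ h0 hlow.le 2
  have hpar := half_sq_norm_sub_le ei ej
  have two : ‖ei‖ ^ 2 + ‖ej‖ ^ 2 ≤ rigidMisfit y xf R c := by
    unfold rigidMisfit
    have hpair : ∑ k ∈ ({i, j} : Finset (Fin n)), ‖xf k - (R (y k) + c)‖ ^ 2 = ‖ei‖ ^ 2 + ‖ej‖ ^ 2 := Finset.sum_pair hij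
    rw [← hpair]
    exact Finset.sum_le_sum_of_subset_of_nonneg (Finset.subset_univ _) fun k _ _ => by positivity
  linarith

/-- the linear part `R − 1` of a linear isometry as a linear map (the `T` of `frame_mul_norm_sq_map_le`). [formal bookkeeping] -/
def motionDefect (R : E3 ≃ₗᵢ[ℝ] E3) : E3 →ₗ[ℝ] E3 := (R.toLinearEquiv : E3 →ₗ[ℝ] E3) - LinearMap.id

/-- `motionDefect R v = R v − v`. [formal bookkeeping] -/
@[simp] theorem motionDefect_apply (R : E3 ≃ₗᵢ[ℝ] E3) (v : E3) : motionDefect R v = R v - v := rfl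

/-- Cauchy–Schwarz with a constant: `Σ_m q m ≤ u·√(Σ_m (q m)²)` over `Fin 3` whenever `3 ≤ u²`, `0 ≤ u`. [formal bookkeeping] -/
theorem sum_le_mul_sqrt_sum_sq (q : Fin 3 → ℝ) {u : ℝ} (hu0 : 0 ≤ u) (hu : 3 ≤ u ^ 2) : ∑ m, q m ≤ u * Real.sqrt (∑ m, q m ^ 2) := by
  have hcs := Finset.sum_mul_sq_le_sq_mul_sq Finset.univ (fun _ : Fin 3 => (1 : ℝ)) q
  simp only [one_mul, one_pow, Finset.sum_const, Finset.card_univ, Fintype.card_fin, nsmul_eq_mul, Nat.cast_ofNat, mul_one] at hcs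
  have hS : 0 ≤ ∑ m, q m ^ 2 := Finset.sum_nonneg fun m _ => sq_nonneg _
  have h1 : (∑ m, q m) ^ 2 ≤ (u * Real.sqrt (∑ m, q m ^ 2)) ^ 2 := by
    rw [mul_pow, Real.sq_sqrt hS]
    exact hcs.trans (mul_le_mul_of_nonneg_right hu hS)
  exact abs_le_of_sq_le_sq' h1 (by positivity) |>.2

/-- ★★ **THE COLLAR PRICE OF A FAR-FROM-IDENTITY MOTION (PROVED)** — the generic class of the dichotomy.  Six sites `idx m σ` (`m : Fin 3` the axis,
`σ : Fin 2` the sign), pairwise distinct, each REGISTERED (`dist (xf ·) (y₀ ·) ≤ ε`) and PINNED for `y` (`dist (y ·) (y₀ ·) ≤ dI₁`), whose reference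
differences `d m = y₀ (idx m 0) − y₀ (idx m 1)` form a perturbed-axes frame (`⟪d m, b m⟫ ≥ L`, off-axis part `≤ w`) for an orthonormal basis `b`;
constants `t² ≤ L²/2 − 2w²`, `3 ≤ u²`.  If `κ‖v‖ < ‖R v − v‖` for SOME `v`, then `(t·κ − 2u(ε + dI₁))²/2 ≤ rigidMisfit y xf R c`.  Mechanism: with
`a_k = y₀ k − (R y₀ k + c)`, `a₊ − a₋ = −(R − 1)(d m)` kills `c`; `Σ_m ‖(R − 1) d m‖² ≥ (L²/2 − 2w²)·κ²` by the frame lemmas; `‖a_k − e_k‖ ≤ ε + dI₁`;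
Minkowski. [this file, g88] -/
theorem rigidMisfit_collar_farId (b : OrthonormalBasis (Fin 3) ℝ E3) (idx : Fin 3 → Fin 2 → Fin n) {ε dI₁ L w κ t u : ℝ}
    (hinj : ∀ m σ m' σ', idx m σ = idx m' σ' → m = m' ∧ σ = σ')
    (hreg : ∀ m σ, dist (xf (idx m σ)) (y₀ (idx m σ)) ≤ ε) (hpin : ∀ m σ, dist (y (idx m σ)) (y₀ (idx m σ)) ≤ dI₁) (hL : 0 ≤ L)
    (hax : ∀ m, L ≤ ⟪y₀ (idx m 0) - y₀ (idx m 1), b m⟫_ℝ)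
    (hperp : ∀ m, ‖(y₀ (idx m 0) - y₀ (idx m 1)) - ⟪y₀ (idx m 0) - y₀ (idx m 1), b m⟫_ℝ • b m‖ ≤ w)
    (ht : t ^ 2 ≤ L ^ 2 / 2 - 2 * w ^ 2) (hu0 : 0 ≤ u) (hu : 3 ≤ u ^ 2) (hκ : 0 ≤ κ)
    (hfar : ∃ v : E3, κ * ‖v‖ < ‖R v - v‖) (hB : 0 ≤ t * κ - 2 * u * (ε + dI₁)) :
    (t * κ - 2 * u * (ε + dI₁)) ^ 2 / 2 ≤ rigidMisfit y xf R c := by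
  have hε : 0 ≤ ε := dist_nonneg.trans (hreg 0 0)
  have hdI : 0 ≤ dI₁ := dist_nonneg.trans (hpin 0 0)
  obtain ⟨η, hη⟩ : ∃ η : ℝ, η = ε + dI₁ := ⟨_, rfl⟩
  rw [← hη] at hB ⊢
  have hη0 : 0 ≤ η := by rw [hη]; exact add_nonneg hε hdI
  have hg0 : 0 ≤ L ^ 2 / 2 - 2 * w ^ 2 := (sq_nonneg t).trans ht
  -- (1) the frame inequality and the Frobenius floor for `R − 1`
  have hframe : ∀ v : E3, (L ^ 2 / 2 - 2 * w ^ 2) * ‖v‖ ^ 2 ≤ ∑ m, ⟪y₀ (idx m 0) - y₀ (idx m 1), v⟫_ℝ ^ 2 :=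
    frame_of_perturbedAxes b (fun m => y₀ (idx m 0) - y₀ (idx m 1)) hL hax hperp
  obtain ⟨v, hv⟩ := hfar
  have hvpos : 0 < ‖v‖ := by
    rcases (norm_nonneg v).eq_or_lt with h | h
    · exfalso
      have hv0 : v = 0 := norm_eq_zero.1 h.symm
      rw [hv0, map_zero, sub_zero, norm_zero, mul_zero] at hv
      exact lt_irrefl _ hv
    · exact h
  have hS1 : (L ^ 2 / 2 - 2 * w ^ 2) * κ ^ 2 ≤ ∑ m, ‖motionDefect R (y₀ (idx m 0) - y₀ (idx m 1))‖ ^ 2 := by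
    have h1 := frame_mul_norm_sq_map_le (motionDefect R) (fun m => y₀ (idx m 0) - y₀ (idx m 1)) hg0 hframe v
    have h2 : κ ^ 2 * ‖v‖ ^ 2 ≤ ‖motionDefect R v‖ ^ 2 := by
      rw [← mul_pow, motionDefect_apply]
      exact pow_le_pow_left₀ (mul_nonneg hκ (norm_nonneg _)) hv.le 2
    have h3 := (mul_le_mul_of_nonneg_left h2 hg0).trans h1
    have h4 : 0 < ‖v‖ ^ 2 := pow_pos hvpos 2
    refine le_of_mul_le_mul_right ?_ h4
    calc (L ^ 2 / 2 - 2 * w ^ 2) * κ ^ 2 * ‖v‖ ^ 2 = (L ^ 2 / 2 - 2 * w ^ 2) * (κ ^ 2 * ‖v‖ ^ 2) := by ring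
      _ ≤ ‖v‖ ^ 2 * ∑ m, ‖motionDefect R (y₀ (idx m 0) - y₀ (idx m 1))‖ ^ 2 := h3
      _ = (∑ m, ‖motionDefect R (y₀ (idx m 0) - y₀ (idx m 1))‖ ^ 2) * ‖v‖ ^ 2 := mul_comm _ _
  -- (2) the six misfit entries and the per-axis bound ‖(R − 1) d m‖ ≤ e₊ + e₋ + 2η
  obtain ⟨e, he⟩ : ∃ e : Fin 3 → Fin 2 → ℝ, ∀ m σ, e m σ = ‖xf (idx m σ) - (R (y (idx m σ)) + c)‖ := ⟨_, fun _ _ => rfl⟩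
  have he0 : ∀ m σ, 0 ≤ e m σ := fun m σ => by rw [he]; exact norm_nonneg _
  have haux : ∀ k : Fin n, dist (xf k) (y₀ k) ≤ ε → dist (y k) (y₀ k) ≤ dI₁ →
      ‖y₀ k - (R (y₀ k) + c)‖ ≤ ‖xf k - (R (y k) + c)‖ + η := by
    intro k hk1 hk2
    have hid : y₀ k - (R (y₀ k) + c) = (xf k - (R (y k) + c)) + ((y₀ k - xf k) - R (y₀ k - y k)) := by rw [map_sub]; abel
    rw [hid]
    refine (norm_add_le _ _).trans (add_le_add le_rfl ?_)
    calc ‖(y₀ k - xf k) - R (y₀ k - y k)‖ ≤ ‖y₀ k - xf k‖ + ‖R (y₀ k - y k)‖ := norm_sub_le _ _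
      _ = dist (xf k) (y₀ k) + dist (y k) (y₀ k) := by
          rw [LinearIsometryEquiv.norm_map, ← dist_eq_norm, ← dist_eq_norm, dist_comm (xf k), dist_comm (y k)]
      _ ≤ η := by rw [hη]; exact add_le_add hk1 hk2
  have hTd : ∀ m, ‖motionDefect R (y₀ (idx m 0) - y₀ (idx m 1))‖ ≤ e m 0 + e m 1 + 2 * η := by
    intro m
    have hid : motionDefect R (y₀ (idx m 0) - y₀ (idx m 1)) =
        -((y₀ (idx m 0) - (R (y₀ (idx m 0)) + c)) - (y₀ (idx m 1) - (R (y₀ (idx m 1)) + c))) := by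
      rw [motionDefect_apply, map_sub]; abel
    rw [hid, norm_neg, he, he]
    calc ‖(y₀ (idx m 0) - (R (y₀ (idx m 0)) + c)) - (y₀ (idx m 1) - (R (y₀ (idx m 1)) + c))‖
        ≤ ‖y₀ (idx m 0) - (R (y₀ (idx m 0)) + c)‖ + ‖y₀ (idx m 1) - (R (y₀ (idx m 1)) + c)‖ := norm_sub_le _ _
      _ ≤ (‖xf (idx m 0) - (R (y (idx m 0)) + c)‖ + η) + (‖xf (idx m 1) - (R (y (idx m 1)) + c)‖ + η) :=
          add_le_add (haux _ (hreg m 0) (hpin m 0)) (haux _ (hreg m 1) (hpin m 1))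
      _ = ‖xf (idx m 0) - (R (y (idx m 0)) + c)‖ + ‖xf (idx m 1) - (R (y (idx m 1)) + c)‖ + 2 * η := by ring
  -- (3) the six squares are below the misfit
  have hE : ∑ m, (e m 0 ^ 2 + e m 1 ^ 2) ≤ rigidMisfit y xf R c := by
    have hfinj : Function.Injective (fun p : Fin 3 × Fin 2 => idx p.1 p.2) := by
      rintro ⟨m, σ⟩ ⟨m', σ'⟩ h
      obtain ⟨h1, h2⟩ := hinj m σ m' σ' h
      rw [h1, h2]
    have hsum : ∑ p : Fin 3 × Fin 2, ‖xf (idx p.1 p.2) - (R (y (idx p.1 p.2)) + c)‖ ^ 2 = ∑ m, (e m 0 ^ 2 + e m 1 ^ 2) := by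
      rw [Fintype.sum_prod_type]
      refine Finset.sum_congr rfl fun m _ => ?_
      rw [Fin.sum_univ_two, he, he]
    have himg : ∑ k ∈ (Finset.univ : Finset (Fin 3 × Fin 2)).image (fun p => idx p.1 p.2), ‖xf k - (R (y k) + c)‖ ^ 2 =
        ∑ p : Fin 3 × Fin 2, ‖xf (idx p.1 p.2) - (R (y (idx p.1 p.2)) + c)‖ ^ 2 :=
      Finset.sum_image fun p _ p' _ h => hfinj h
    rw [← hsum, ← himg]
    unfold rigidMisfit
    exact Finset.sum_le_sum_of_subset_of_nonneg (Finset.subset_univ _) fun k _ _ => by positivity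
  -- (4) Minkowski: t κ ≤ √Q + 2 u η with Q = Σ_m (e₊ + e₋)² ≤ 2·(the six squares)
  obtain ⟨Q, hQ⟩ : ∃ Q : ℝ, Q = ∑ m, (e m 0 + e m 1) ^ 2 := ⟨_, rfl⟩
  have hQ0 : 0 ≤ Q := by rw [hQ]; exact Finset.sum_nonneg fun m _ => sq_nonneg _
  have hQE : Q ≤ 2 * ∑ m, (e m 0 ^ 2 + e m 1 ^ 2) := by
    rw [hQ, Finset.mul_sum]
    exact Finset.sum_le_sum fun m _ => by nlinarith [sq_nonneg (e m 0 - e m 1)]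
  have h3 : ∑ m, (e m 0 + e m 1) ≤ u * Real.sqrt Q := by
    rw [hQ]; exact sum_le_mul_sqrt_sum_sq (fun m => e m 0 + e m 1) hu0 hu
  have hstep : (t * κ) ^ 2 ≤ (Real.sqrt Q + 2 * u * η) ^ 2 := by
    have h1 : ∑ m, ‖motionDefect R (y₀ (idx m 0) - y₀ (idx m 1))‖ ^ 2 ≤ ∑ m, (e m 0 + e m 1 + 2 * η) ^ 2 :=
      Finset.sum_le_sum fun m _ => pow_le_pow_left₀ (norm_nonneg _) (hTd m) 2
    have h2 : ∑ m, (e m 0 + e m 1 + 2 * η) ^ 2 = Q + 4 * η * ∑ m, (e m 0 + e m 1) + 12 * η ^ 2 := by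
      rw [hQ]; simp only [Fin.sum_univ_three]; ring
    have h4 : 12 * η ^ 2 ≤ (2 * u * η) ^ 2 := by nlinarith [sq_nonneg η]
    have h5 : (Real.sqrt Q + 2 * u * η) ^ 2 = Q + 4 * η * (u * Real.sqrt Q) + (2 * u * η) ^ 2 := by
      rw [add_sq, Real.sq_sqrt hQ0]; ring
    have h6 : (t * κ) ^ 2 ≤ (L ^ 2 / 2 - 2 * w ^ 2) * κ ^ 2 := by
      rw [mul_pow]; exact mul_le_mul_of_nonneg_right ht (sq_nonneg _)
    have h7 : 4 * η * ∑ m, (e m 0 + e m 1) ≤ 4 * η * (u * Real.sqrt Q) := mul_le_mul_of_nonneg_left h3 (by linarith)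
    calc (t * κ) ^ 2 ≤ ∑ m, ‖motionDefect R (y₀ (idx m 0) - y₀ (idx m 1))‖ ^ 2 := h6.trans hS1
      _ ≤ Q + 4 * η * ∑ m, (e m 0 + e m 1) + 12 * η ^ 2 := h1.trans h2.le
      _ ≤ Q + 4 * η * (u * Real.sqrt Q) + (2 * u * η) ^ 2 := by linarith
      _ = (Real.sqrt Q + 2 * u * η) ^ 2 := h5.symm
  have hstep2 : t * κ ≤ Real.sqrt Q + 2 * u * η := by
    have h0 : 0 ≤ Real.sqrt Q + 2 * u * η := add_nonneg (Real.sqrt_nonneg _) (mul_nonneg (mul_nonneg (by norm_num) hu0) hη0)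
    exact abs_le_of_sq_le_sq' hstep h0 |>.2
  have hstep3 : (t * κ - 2 * u * η) ^ 2 ≤ Q := by
    have h1 : t * κ - 2 * u * η ≤ Real.sqrt Q := by linarith
    have h2 := pow_le_pow_left₀ hB h1 2
    rwa [Real.sq_sqrt hQ0] at h2
  linarith

end Prices

end Summit.AtomisticToContinuum.Crystallization.Theorems.ChartedZeroExcessLayeredLatticeLiouville

end
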